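import Mathlib
import Literature.AlgebraicGeometry.Resolution.CobordantGame
import Literature.AlgebraicGeometry.Resolution.CobordantChartCoefficients
import Literature.AlgebraicGeometry.Resolution.CobordantTupleGame
import Literature.AlgebraicGeometry.Resolution.FormalCoordinateChange
import Summits.ResolutionOfSingularities.ResolutionOfSingularities.Theorems.WeightedInvariantLocalWeightedDropWildMonicDescentTwo
import Summits.ResolutionOfSingularities.ResolutionOfSingularities.Theorems.WeightedInvariantLocalWeightedDropWonMultiplicity

/-!
# `WeightedInvariant.LocalWeightedDrop`, line `hasse-ridge-face-selection`: the S3ρ composition, THIRD FORM — the datum may also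
# exit on NON-REDUCED positions

Crux item stmt-ResolutionOfSingularities-8899 `LocalWeightedDrop` (route `ResolutionOfSingularities/WeightedInvariant`), engine of
the door `HypersurfaceCentreConstruction` stmt-ResolutionOfSingularities-19897.  [OURS · L1 W4.3, chain w43, res-type-083 (extra
seat S3ρ, CHAIN v4.3 D12).  Not a statement of any manuscript.]

The registered piece S3ρ ranges over ALL monic positions, non-reduced ones included (e.g. `(y² + x₁³)³ + …`), while the printed
descent (Perlega 2017/2020 / CJS) is stated for reduced surfaces.  `wildMonicSurfaceReductionWon_of_descent₃`: as the second form
(`…_of_descent₂`: slot choice, zero-tuple exit), with ONE MORE EXIT after the free moves — a factorisation of the monic form as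
`U · ∏ᵢ Qᵢ^{mᵢ}` (`U` a unit, `mᵢ ≥ 1`) whose reduction `∏ᵢ Qᵢ` has order `< d`: then `∏ Qᵢ` is won by the hypothesis on smaller
orders (or is not singular at all) and `WonMultiplicity.won_unit_mul_prod_pow` wins the position.  So the descent datum S3ρD owes the
step property ONLY at positions admitting no such factorisation.
-/

set_option linter.dupNamespace false -- mandated namespace of this single-conjunct summit

namespace Summit.ResolutionOfSingularities.ResolutionOfSingularities.Theorems

open Literature.AlgebraicGeometry.Resolution
open Literature.AlgebraicGeometry.Resolution.CobordantGame

namespace WildMonic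

open MvPowerSeries

variable {k : Type} [Field k]

/-- S3ρ `stub_wildMonicSurfaceReductionWon` VERBATIM FROM THE PIECES, THIRD FORM: as the second form, plus the exit
«NON-REDUCED»: a factorisation `U · ∏ Qᵢ^{mᵢ}` of the monic form whose reduction `∏ Qᵢ` has order `< d`. -/
theorem wildMonicSurfaceReductionWon_of_descent₃
    (Term : ∀ (k : Type) [Field k] (d : ℕ), (Fin d → MvPowerSeries (Fin 2) k) → Prop)
    (hterm : ∀ (p : ℕ), p.Prime → ∀ (k : Type) [Field k] [CharP k p] [IsAlgClosed k],
      ∀ (d : ℕ), p ∣ d → 2 < d →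
      (∀ g : MvPowerSeries (Fin 3) k, CobordantGame.IsSingular k g → g.order < d →
        CobordantGame.Won k 3 g) →
      (∀ g : MvPowerSeries (Fin 3) k, CobordantGame.IsSingular k g → g.order = d →
        (∃ c : Fin 3 → k, c ≠ 0 ∧ ∀ v : Fin 3 → k,
          CobordantChart.initEval (fun _ : Fin 3 => 1) (v + c) d g =
            CobordantChart.initEval (fun _ : Fin 3 => 1) v d g) →
        (∀ c₁ c₂ : Fin 3 → k,
          (∀ v : Fin 3 → k, CobordantChart.initEval (fun _ : Fin 3 => 1) (v + c₁) d g =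
            CobordantChart.initEval (fun _ : Fin 3 => 1) v d g) →
          (∀ v : Fin 3 → k, CobordantChart.initEval (fun _ : Fin 3 => 1) (v + c₂) d g =
            CobordantChart.initEval (fun _ : Fin 3 => 1) v d g) →
          ∃ α β : k, (α ≠ 0 ∨ β ≠ 0) ∧ α • c₁ + β • c₂ = 0) →
        CobordantGame.Won k 3 g) →
      ∀ A : Fin d → MvPowerSeries (Fin 2) k, (∀ j : Fin d, ((d - (j : ℕ) : ℕ) : ℕ∞) < (A j).order) → Term k d A →
        CobordantGame.Won k 3 (MvPowerSeries.X (Fin.last 2) ^ d +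
          ∑ j : Fin d, MvPowerSeries.rename (Fin.succAboveEmb (Fin.last 2)) (A j) * MvPowerSeries.X (Fin.last 2) ^ (j : ℕ)))
    (hdesc : ∀ (p : ℕ), p.Prime → ∀ (k : Type) [Field k] [CharP k p] [IsAlgClosed k],
      (∀ m : ℕ, m < 3 → ∀ g : MvPowerSeries (Fin m) k,
        CobordantGame.IsSingular k g → CobordantGame.Won k m g) →
      ∀ (d : ℕ), p ∣ d → 2 < d →
      (∀ g : MvPowerSeries (Fin 3) k, CobordantGame.IsSingular k g → g.order < d →
        CobordantGame.Won k 3 g) →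
      (∀ g : MvPowerSeries (Fin 3) k, CobordantGame.IsSingular k g → g.order = d →
        (∃ c : Fin 3 → k, c ≠ 0 ∧ ∀ v : Fin 3 → k,
          CobordantChart.initEval (fun _ : Fin 3 => 1) (v + c) d g =
            CobordantChart.initEval (fun _ : Fin 3 => 1) v d g) →
        (∀ c₁ c₂ : Fin 3 → k,
          (∀ v : Fin 3 → k, CobordantChart.initEval (fun _ : Fin 3 => 1) (v + c₁) d g =
            CobordantChart.initEval (fun _ : Fin 3 => 1) v d g) →
          (∀ v : Fin 3 → k, CobordantChart.initEval (fun _ : Fin 3 => 1) (v + c₂) d g =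
            CobordantChart.initEval (fun _ : Fin 3 => 1) v d g) →
          ∃ α β : k, (α ≠ 0 ∨ β ≠ 0) ∧ α • c₁ + β • c₂ = 0) →
        CobordantGame.Won k 3 g) →
      ∃ (S : Type) (germ : S → Fin d → MvPowerSeries (Fin 2) k) (μ : S → Ordinal.{0}),
        (∀ A : Fin d → MvPowerSeries (Fin 2) k, (∀ j : Fin d, ((d - (j : ℕ) : ℕ) : ℕ∞) < (A j).order) →
          ∃ s, germ s = A) ∧
        (∀ s : S, (∀ j : Fin d, ((d - (j : ℕ) : ℕ) : ℕ∞) < (germ s j).order) →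
          ∃ (θ : Fin 2 → MvPowerSeries (Fin 2) k) (φ : MvPowerSeries (Fin 2) k),
            (∀ i, constantCoeff (θ i) = 0) ∧ IsUnit (FormalCoordChange.linMat θ).det ∧ constantCoeff φ = 0 ∧
            (∀ j : Fin d, ((d - (j : ℕ) : ℕ) : ℕ∞) < (shift d (fun j => subst θ (germ s j)) φ j).order) ∧
            ((Term k d (shift d (fun j => subst θ (germ s j)) φ) ∨
              ((∃ e : ℕ, d = p ^ e) ∧ ∀ j : Fin d, (j : ℕ) ≠ 0 → shift d (fun j => subst θ (germ s j)) φ j = 0) ∨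
              (∃ (r : ℕ) (Q : Fin r → MvPowerSeries (Fin (2 + 1)) k) (mQ : Fin r → ℕ) (U : MvPowerSeries (Fin (2 + 1)) k),
                (∀ i, 1 ≤ mQ i) ∧ constantCoeff U ≠ 0 ∧
                ((X (Fin.last 2) : MvPowerSeries (Fin (2 + 1)) k) ^ d +
                  ∑ j : Fin d, rename (Fin.succAboveEmb (Fin.last 2)) (shift d (fun j => subst θ (germ s j)) φ j) *
                    X (Fin.last 2) ^ (j : ℕ) = U * ∏ i, Q i ^ mQ i) ∧
                (∏ i, Q i).order < d)) ∨
              (∀ j : Fin d, shift d (fun j => subst θ (germ s j)) φ j = 0) ∨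
              ∀ (c : Fin 2 → k), (∃ i, c i ≠ 0) → ∀ Bv : Fin d → MvPowerSeries (Fin (2 + 1)) k,
                (∀ j : Fin d, subst (CobordantChart.chart (fun _ : Fin 2 => 1) c)
                  (shift d (fun j => subst θ (germ s j)) φ j) = X 0 ^ (d - (j : ℕ) + 1) * Bv j) →
                ∃ i₀ : Fin 2, c i₀ ≠ 0 ∧
                (CobordantGame.IsSingular k ((X (Fin.last 2) : MvPowerSeries (Fin (2 + 1)) k) ^ d +
                  ∑ j : Fin d, rename (Fin.succAboveEmb (Fin.last 2)) (TupleGame.slice i₀ (X 0 * Bv j)) *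
                    X (Fin.last 2) ^ (j : ℕ)) →
                ((X (Fin.last 2) : MvPowerSeries (Fin (2 + 1)) k) ^ d +
                  ∑ j : Fin d, rename (Fin.succAboveEmb (Fin.last 2)) (TupleGame.slice i₀ (X 0 * Bv j)) *
                    X (Fin.last 2) ^ (j : ℕ)).order = d →
                (∃ c₁ c₂ : Fin 3 → k, (∀ α β : k, α • c₁ + β • c₂ = 0 → α = 0 ∧ β = 0) ∧
                  (∀ v : Fin 3 → k, CobordantChart.initEval (fun _ : Fin 3 => 1) (v + c₁) d
                    ((X (Fin.last 2) : MvPowerSeries (Fin (2 + 1)) k) ^ d +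
                      ∑ j : Fin d, rename (Fin.succAboveEmb (Fin.last 2)) (TupleGame.slice i₀ (X 0 * Bv j)) *
                        X (Fin.last 2) ^ (j : ℕ)) =
                    CobordantChart.initEval (fun _ : Fin 3 => 1) v d
                    ((X (Fin.last 2) : MvPowerSeries (Fin (2 + 1)) k) ^ d +
                      ∑ j : Fin d, rename (Fin.succAboveEmb (Fin.last 2)) (TupleGame.slice i₀ (X 0 * Bv j)) *
                        X (Fin.last 2) ^ (j : ℕ))) ∧
                  (∀ v : Fin 3 → k, CobordantChart.initEval (fun _ : Fin 3 => 1) (v + c₂) d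
                    ((X (Fin.last 2) : MvPowerSeries (Fin (2 + 1)) k) ^ d +
                      ∑ j : Fin d, rename (Fin.succAboveEmb (Fin.last 2)) (TupleGame.slice i₀ (X 0 * Bv j)) *
                        X (Fin.last 2) ^ (j : ℕ)) =
                    CobordantChart.initEval (fun _ : Fin 3 => 1) v d
                    ((X (Fin.last 2) : MvPowerSeries (Fin (2 + 1)) k) ^ d +
                      ∑ j : Fin d, rename (Fin.succAboveEmb (Fin.last 2)) (TupleGame.slice i₀ (X 0 * Bv j)) *
                        X (Fin.last 2) ^ (j : ℕ)))) →
                ∀ μ' : Fin 2 → k,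
                  (∀ j : Fin d, ((d - (j : ℕ) : ℕ) : ℕ∞) <
                    (shift d (fun j => TupleGame.slice i₀ (X 0 * Bv j)) (-(∑ i : Fin 2, C (μ' i) * X i)) j).order) →
                  ∃ s' : S, germ s' = shift d (fun j => TupleGame.slice i₀ (X 0 * Bv j))
                      (-(∑ i : Fin 2, C (μ' i) * X i)) ∧ μ s' < μ s)))) :
    ∀ (p : ℕ), p.Prime → ∀ (k : Type) [Field k] [CharP k p] [IsAlgClosed k],
      (∀ m : ℕ, m < 3 → ∀ g : MvPowerSeries (Fin m) k,
        CobordantGame.IsSingular k g → CobordantGame.Won k m g) →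
      ∀ (d : ℕ), p ∣ d → 2 < d →
      (∀ g : MvPowerSeries (Fin 3) k, CobordantGame.IsSingular k g → g.order < d →
        CobordantGame.Won k 3 g) →
      (∀ g : MvPowerSeries (Fin 3) k, CobordantGame.IsSingular k g → g.order = d →
        (∃ c : Fin 3 → k, c ≠ 0 ∧ ∀ v : Fin 3 → k,
          CobordantChart.initEval (fun _ : Fin 3 => 1) (v + c) d g =
            CobordantChart.initEval (fun _ : Fin 3 => 1) v d g) →
        (∀ c₁ c₂ : Fin 3 → k,
          (∀ v : Fin 3 → k, CobordantChart.initEval (fun _ : Fin 3 => 1) (v + c₁) d g =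
            CobordantChart.initEval (fun _ : Fin 3 => 1) v d g) →
          (∀ v : Fin 3 → k, CobordantChart.initEval (fun _ : Fin 3 => 1) (v + c₂) d g =
            CobordantChart.initEval (fun _ : Fin 3 => 1) v d g) →
          ∃ α β : k, (α ≠ 0 ∨ β ≠ 0) ∧ α • c₁ + β • c₂ = 0) →
        CobordantGame.Won k 3 g) →
      ((∃ e : ℕ, d = p ^ e) → ∀ (A₀ : MvPowerSeries (Fin 2) k), (d : ℕ∞) < A₀.order →
        CobordantGame.Won k 3 (MvPowerSeries.X (Fin.last 2) ^ d +
          MvPowerSeries.rename (Fin.succAboveEmb (Fin.last 2)) A₀)) →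
      ∀ A : Fin d → MvPowerSeries (Fin 2) k, (∀ j : Fin d, ((d - (j : ℕ) : ℕ) : ℕ∞) < (A j).order) →
        CobordantGame.Won k 3 (MvPowerSeries.X (Fin.last 2) ^ d +
          ∑ j : Fin d, MvPowerSeries.rename (Fin.succAboveEmb (Fin.last 2)) (A j) * MvPowerSeries.X (Fin.last 2) ^ (j : ℕ)) := by
  intro p hp k _ _ _ hlow d hpd h2d hord haxis hpure A hA
  have hd : 0 < d := by omega
  obtain ⟨S, germ, μ, hcover, hstep⟩ := hdesc p hp k hlow d hpd h2d hord haxis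
  obtain ⟨s, hs⟩ := hcover A hA
  rw [← hs]
  refine monic_won_of_descent₂ p hp k hd hord haxis
    (fun A => Term k d A ∨ ((∃ e : ℕ, d = p ^ e) ∧ ∀ j : Fin d, (j : ℕ) ≠ 0 → A j = 0) ∨
      (∃ (r : ℕ) (Q : Fin r → MvPowerSeries (Fin (2 + 1)) k) (mQ : Fin r → ℕ) (U : MvPowerSeries (Fin (2 + 1)) k),
        (∀ i, 1 ≤ mQ i) ∧ constantCoeff U ≠ 0 ∧
        ((X (Fin.last 2) : MvPowerSeries (Fin (2 + 1)) k) ^ d +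
          ∑ j : Fin d, rename (Fin.succAboveEmb (Fin.last 2)) (A j) * X (Fin.last 2) ^ (j : ℕ) = U * ∏ i, Q i ^ mQ i) ∧
        (∏ i, Q i).order < d)) ?_ germ μ ?_ s (by rw [hs]; exact hA)
  · -- the exits: terminal classes (S3ρT), pure `p^e`-th power forms (hypothesis of S3ρ), non-reduced forms (multiplicity lemma)
    intro B hB hT
    rcases hT with hTB | ⟨hpe, hpureB⟩ | ⟨r, Q, mQ, U, hmQ, hU, hBeq, hordQ⟩
    · exact hterm p hp k d hpd h2d hord haxis B hB hTB
    · rw [monicForm_eq_purePower hd B hpureB]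
      have h0 := hB ⟨0, hd⟩
      rw [Nat.sub_zero] at h0
      exact hpure hpe (B ⟨0, hd⟩) h0
    · rw [hBeq]
      have hred : CobordantGame.Won k (2 + 1) (∏ i, Q i) := by
        by_cases hQs : CobordantGame.IsSingular k (∏ i, Q i)
        · exact hord _ hQs hordQ
        · exact (wonBy_zero_of_not_isSingular (by norm_num) hQs).won
      exact WonMultiplicity.won_unit_mul_prod_pow hred Q mQ U hmQ hU rfl
  · intro s' hs'
    obtain ⟨θ, φ, hθ0, hθdet, hφ0, hA₁, hbr⟩ := hstep s' hs'
    refine ⟨θ, φ, hθ0, hθdet, hφ0, hA₁, ?_⟩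
    rcases hbr with (hT | hP | hN) | hZ | hpt
    · exact Or.inl (Or.inl hT)
    · exact Or.inl (Or.inr (Or.inl hP))
    · exact Or.inl (Or.inr (Or.inr hN))
    · exact Or.inr (Or.inl hZ)
    · exact Or.inr (Or.inr hpt)

end WildMonic

end Summit.ResolutionOfSingularities.ResolutionOfSingularities.Theorems
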